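import Literature.NumberTheory.Rogawski1990.OneDimAutRepH
import Literature.NumberTheory.Automorphic.UnitaryLineArchTypes
import Literature.NumberTheory.Automorphic.UnitaryGroupAdelicCenterRational
import Summits.HodgeConjecture.HodgeConjecture.Theorems.F0P3XiArchDataOfRecord
import HarnessLib

/-!
# The archimedean exponent of `η² ψ³ μ|_T` at an embedding `ι` (organ O-ARCH «archimedean exponent» of the «ZENTRUM» sub-leaf)

Cell `hodgecm-mathlib`, crux H413 (`stmt-HodgeConjecture-24833`), LH1 chapter «ZENTRUM» (LH1-plan (g4) sketch
`ZentrumCentralIota.sketch.v4`, organ `XiCentralCharArchExponentLetter`).  PROOF FILE, `--supports` lane: theorems only (no definition,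
no instance, no notation, no named fact, no `sorry`).

THE STATEMENT (`xiCentralCharArchExponent`, and its `∀`-closed form `xiCentralCharArchExponent_forall` = the letter's body token for token).
For a CM field `L`, an embedding `ι : L →+* ℂ`, a pair `ξ = (η, ψ)` of automorphic characters of the norm-one torus `T(𝔸_{L⁺})` (★
`Rogawski1990.OneDimAutRepH`), and a unitary Hecke character `μω` of `L` with `μω|_{𝕀_{L⁺}} = ω_{L/L⁺}`: if the character
`t ↦ η(t)² ψ(t)³ μω(t)` of `T(𝔸_{L⁺})` is trivial on the archimedean torus `T_∞ = U(1)(L⁺ ⊗ ℝ) = relNormOneInfUnits L⁺ L` (elements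
`(y, 1)`), then its exponent at `ι` vanishes:
`3·qψ ι + 2·(pη ι + t_ι) + 1 = 0`, `t_ι = tOfArchType (archTypeOfRecord μω) ι`.

THE PROOF (pure bookkeeping, `P`-free).  On `(y, 1)`, `y ∈ T_∞ ≅ ∏_{w ∣ ∞} U(1)` (★ `relNormOneInfUnitsEquivCircles`): `η(y,1) = ∏_w ι_w(y_w)^{−eη w}`,
`ψ(y,1) = ∏_w ι_w(y_w)^{−eψ w}` (★ `OneDimAutRepH.η_arch_apply` ∕ `ψ_arch_apply`), `μω(y,1) = ∏_w ι_w(y_w)^{k₀ w}` with `k₀ = archTypeOfRecord μω`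
the (odd) unitary archimedean type of record (★ `hasUnitaryArchType_archTypeOfRecord`, ★ `odd_archTypeOfRecord`; `|ι_w(y_w)| = 1`).  So the
character is the typed weight ★ `archWeight L m` with `m w = k₀ w − 2·eη w − 3·eψ w`; a trivial typed weight has type `0` (★ `archWeight_injective`),
whence `k₀ w = 2·eη w + 3·eψ w` at every infinite place `w`.  At `w = mk ι`: if `ι = ι_w` then `pη ι = −eη w`, `qψ ι = −eψ w`, `2 t_ι + 1 = k₀ w`; if
`ι = ῑ_w` all three change sign (`(p, q, t) ↦ (−p, −q, −t−1)`, ★ `expAt`); either way `3q + 2(p + t) + 1 = ∓(3 eψ w + 2 eη w − k₀ w) = 0`.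

R-CAL NOTE.  The identity is invariant under the conjugation symmetry, so only a GLOBAL sign slip between ★ `expAt` (`η_ι(u) = ι(u)^{pη ι}`)
and ★ `archUnitaryValue` (`μω_w(z) = (ι_w z/|ι_w z|)^{k₀ w}`) could break it; the kernel confirms the letter AS TYPED.

References: [Rogawski1990] J. Rogawski, *Automorphic Representations of Unitary Groups in Three Variables* (1990), §12.3 pp. 174, 178
(`η_ι(u) = u^p`, `ψ_ι(u) = u^q`, `μ_ι(z) = (z/z̄)^{t+1/2}`); [Arthur2011Draft] d-p.319 (§6.2 Remark 2) (archimedean types of automorphic characters of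
`U(1)`); [BrockerTomDieck1985] Ch. II Prop. (8.1) (characters of tori).  HC_CM is proved only modulo the printed citations until rung 0 closes.
-/

set_option autoImplicit false
set_option linter.dupNamespace false

noncomputable section

open NumberField IsDedekindDomain
open scoped Classical

namespace Summit.HodgeConjecture.HodgeConjecture.Cruxes.H413.F0P3cXiCentralCharArchExponent

open Literature.NumberTheory.Automorphic Literature.NumberTheory.Automorphic.UnitaryGroup
open Literature.NumberTheory.Automorphic.Arthur2013.Leaves.TECR
open Literature.NumberTheory.GaloisRepresentations
open Literature.NumberTheory.Rogawski1990
open Summit.HodgeConjecture.HodgeConjecture.Cruxes.H413.F0P3XiArchDataOfRecord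

variable {L : Type} [Field L] [NumberField L] [IsCMField L]

/-! ## §1 The archimedean torus element `(y, 1)` in the three currencies -/

/-- The torus element `(y, 1) ∈ T(𝔸_{L⁺})` attached to `y ∈ U(1)(L⁺ ⊗ ℝ)` through `relNormOneInfToIdeles`, the CM identification
`U(1)(𝔸_{L⁺}) = ker N_{L/L⁺}` and `U(1)(𝔸) ≃ T(𝔸)` IS the archimedean idèle `infiniteIdeles L y` (all three maps are the identity on underlying
idèles). [cite: PlatonovRapinchuk1994, §6.2] -/
theorem coe_archTorusElt (y : ↥(relNormOneInfUnits (↥(maximalRealSubfield L)) L)) :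
    ((adelicOneEquivTorus (↥(maximalRealSubfield L)) L (IsCMField.complexConj L)
        ((cmAdelicOneEquivRelNormOne L).symm (relNormOneInfToIdeles (↥(maximalRealSubfield L)) L y)) :
        ↥(TorusDict.torus (IsCMField.complexConj L))) : ideleGroup L) =
      infiniteIdeles L (y : (InfiniteAdeleRing L)ˣ) := rfl

/-- `(y, 1)` lies in the torus `T(𝔸_{L⁺})`. [cite: PlatonovRapinchuk1994, §6.2] -/
theorem infiniteIdeles_mem_torus (y : ↥(relNormOneInfUnits (↥(maximalRealSubfield L)) L)) :
    infiniteIdeles L (y : (InfiniteAdeleRing L)ˣ) ∈ TorusDict.torus (IsCMField.complexConj L) :=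
  (adelicOneEquivTorus (↥(maximalRealSubfield L)) L (IsCMField.complexConj L)
    ((cmAdelicOneEquivRelNormOne L).symm (relNormOneInfToIdeles (↥(maximalRealSubfield L)) L y))).2

/-- The torus element `(y, 1)` as the anonymous-constructor subtype term over `infiniteIdeles L y`. [cite: PlatonovRapinchuk1994, §6.2] -/
theorem archTorusElt_eq_mk (y : ↥(relNormOneInfUnits (↥(maximalRealSubfield L)) L)) :
    adelicOneEquivTorus (↥(maximalRealSubfield L)) L (IsCMField.complexConj L)
        ((cmAdelicOneEquivRelNormOne L).symm (relNormOneInfToIdeles (↥(maximalRealSubfield L)) L y)) =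
      ⟨infiniteIdeles L (y : (InfiniteAdeleRing L)ˣ), infiniteIdeles_mem_torus y⟩ :=
  Subtype.ext rfl

/-! ## §2 The three archimedean readings on `(y, 1)` as powers of the weight characters `ι_w(y_w)` -/

/-- `η(y, 1) = ∏_w ι_w(y_w)^{−eη w}` in the weight-character currency ★ `archPlaceChar`. [cite: Arthur2011Draft, d-p.319 (§6.2 Remark 2)] -/
theorem η_archTorusElt (ξ : OneDimAutRepH L) (y : ↥(relNormOneInfUnits (↥(maximalRealSubfield L)) L)) :
    ((ξ.η (adelicOneEquivTorus (↥(maximalRealSubfield L)) L (IsCMField.complexConj L)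
        ((cmAdelicOneEquivRelNormOne L).symm (relNormOneInfToIdeles (↥(maximalRealSubfield L)) L y))) : ℂˣ) : ℂ) =
      ∏ w : InfinitePlace L, ((archPlaceChar L w y : Circle) : ℂ) ^ (-ξ.eη w) := by
  rw [archTorusElt_eq_mk, ξ.η_arch_apply]
  rfl

/-- `ψ(y, 1) = ∏_w ι_w(y_w)^{−eψ w}`. [cite: Arthur2011Draft, d-p.319 (§6.2 Remark 2)] -/
theorem ψ_archTorusElt (ξ : OneDimAutRepH L) (y : ↥(relNormOneInfUnits (↥(maximalRealSubfield L)) L)) :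
    ((ξ.ψ (adelicOneEquivTorus (↥(maximalRealSubfield L)) L (IsCMField.complexConj L)
        ((cmAdelicOneEquivRelNormOne L).symm (relNormOneInfToIdeles (↥(maximalRealSubfield L)) L y))) : ℂˣ) : ℂ) =
      ∏ w : InfinitePlace L, ((archPlaceChar L w y : Circle) : ℂ) ^ (-ξ.eψ w) := by
  rw [archTorusElt_eq_mk, ξ.ψ_arch_apply]
  rfl

/-- `μω(y, 1) = ∏_w ι_w(y_w)^{k w}` for a Hecke character of unitary archimedean type `(k, 0)` — on the norm-one torus `|ι_w(y_w)| = 1`.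
[cite: Patrikis2019, §2.1] -/
theorem heckeCharacter_archTorusElt {μω : HeckeCharacter L} {k : InfinitePlace L → ℤ}
    (hk : μω.HasUnitaryArchType k (fun _ => 0)) (y : ↥(relNormOneInfUnits (↥(maximalRealSubfield L)) L)) :
    ((μω (infiniteIdeles L (y : (InfiniteAdeleRing L)ˣ)) : ℂˣ) : ℂ) =
      ∏ w : InfinitePlace L, ((archPlaceChar L w y : Circle) : ℂ) ^ (k w) := by
  rw [hk]
  refine Finset.prod_congr rfl fun w _ => ?_
  have h1 : ‖InfinitePlace.Completion.extensionEmbedding w (((y : (InfiniteAdeleRing L)ˣ) : InfiniteAdeleRing L) w)‖ = 1 := by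
    rw [← coe_archPlaceChar]
    exact Circle.norm_coe _
  simp only [archUnitaryValue, h1, Complex.ofReal_one, div_one, Complex.ofReal_zero, zero_mul, Complex.cpow_zero, mul_one,
    coe_archPlaceChar]

/-- **The character `η² ψ³ μω` on `(y, 1)` is the typed weight of type `k − 2eη − 3eψ`** (★ `archWeight`).
[cite: Rogawski1990, §12.3 p. 178] -/
theorem etaSq_psiCube_mu_archTorusElt (ξ : OneDimAutRepH L) {μω : HeckeCharacter L} {k : InfinitePlace L → ℤ}
    (hk : μω.HasUnitaryArchType k (fun _ => 0)) (y : ↥(relNormOneInfUnits (↥(maximalRealSubfield L)) L)) :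
    (((ξ.η (adelicOneEquivTorus (↥(maximalRealSubfield L)) L (IsCMField.complexConj L)
          ((cmAdelicOneEquivRelNormOne L).symm (relNormOneInfToIdeles (↥(maximalRealSubfield L)) L y))) ^ 2 *
        ξ.ψ (adelicOneEquivTorus (↥(maximalRealSubfield L)) L (IsCMField.complexConj L)
          ((cmAdelicOneEquivRelNormOne L).symm (relNormOneInfToIdeles (↥(maximalRealSubfield L)) L y))) ^ 3 *
        μω (((cmAdelicOneEquivRelNormOne L).symm (relNormOneInfToIdeles (↥(maximalRealSubfield L)) L y) :
          ↥(adelicOne (↥(maximalRealSubfield L)) L (IsCMField.complexConj L))) : ideleGroup L) : ℂˣ) : ℂ)) =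
      archWeight L (fun w => k w - 2 * ξ.eη w - 3 * ξ.eψ w) y := by
  have hμ : ((μω (((cmAdelicOneEquivRelNormOne L).symm (relNormOneInfToIdeles (↥(maximalRealSubfield L)) L y) :
          ↥(adelicOne (↥(maximalRealSubfield L)) L (IsCMField.complexConj L))) : ideleGroup L) : ℂˣ) : ℂ) =
      ∏ w : InfinitePlace L, ((archPlaceChar L w y : Circle) : ℂ) ^ (k w) :=
    heckeCharacter_archTorusElt hk y
  rw [Units.val_mul, Units.val_mul, Units.val_pow_eq_pow_val, Units.val_pow_eq_pow_val, η_archTorusElt, ψ_archTorusElt, hμ,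
    archWeight_eq_prod, ← Finset.prod_pow, ← Finset.prod_pow, ← Finset.prod_mul_distrib, ← Finset.prod_mul_distrib]
  refine Finset.prod_congr rfl fun w _ => ?_
  have hz : ((archPlaceChar L w y : Circle) : ℂ) ≠ 0 := Circle.coe_ne_zero _
  rw [← zpow_natCast, ← zpow_natCast, ← zpow_mul, ← zpow_mul, ← zpow_add₀ hz, ← zpow_add₀ hz]
  congr 1
  push_cast
  ring

/-! ## §3 The exponent identity -/

/-- **A trivial typed weight has type zero, read for `η² ψ³ μω`**: if `η(y,1)² ψ(y,1)³ μω(y,1) = 1` for every `y ∈ U(1)(L⁺ ⊗ ℝ)` then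
`k w = 2·eη w + 3·eψ w` at every infinite place `w` (★ `archWeight_injective`). [cite: BrockerTomDieck1985, Ch. II Prop. (8.1)] -/
theorem archType_eq_of_trivial (ξ : OneDimAutRepH L) {μω : HeckeCharacter L} {k : InfinitePlace L → ℤ}
    (hk : μω.HasUnitaryArchType k (fun _ => 0))
    (h : ∀ y : ↥(relNormOneInfUnits (↥(maximalRealSubfield L)) L),
        ξ.η (adelicOneEquivTorus (↥(maximalRealSubfield L)) L (IsCMField.complexConj L)
            ((cmAdelicOneEquivRelNormOne L).symm (relNormOneInfToIdeles (↥(maximalRealSubfield L)) L y))) ^ 2 *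
          ξ.ψ (adelicOneEquivTorus (↥(maximalRealSubfield L)) L (IsCMField.complexConj L)
            ((cmAdelicOneEquivRelNormOne L).symm (relNormOneInfToIdeles (↥(maximalRealSubfield L)) L y))) ^ 3 *
          μω (((cmAdelicOneEquivRelNormOne L).symm (relNormOneInfToIdeles (↥(maximalRealSubfield L)) L y) :
            ↥(adelicOne (↥(maximalRealSubfield L)) L (IsCMField.complexConj L))) : ideleGroup L) = 1)
    (w : InfinitePlace L) : k w = 2 * ξ.eη w + 3 * ξ.eψ w := by
  have hW : archWeight L (fun w => k w - 2 * ξ.eη w - 3 * ξ.eψ w) = archWeight L 0 := by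
    refine MonoidHom.ext fun y => ?_
    rw [← etaSq_psiCube_mu_archTorusElt ξ hk y, h y, Units.val_one, archWeight_zero]
  have h0 := congr_fun (archWeight_injective hW) w
  simp only [Pi.zero_apply] at h0
  omega

/-- **ORGAN O-ARCH (the letter `XiCentralCharArchExponentLetter`, curried)**: if `η² ψ³ μω|_T` is trivial on the archimedean torus
`U(1)(L⁺ ⊗ ℝ)` then `3·qψ ι + 2·(pη ι + t_ι) + 1 = 0` with `t_ι = tOfArchType (archTypeOfRecord μω) ι` — Rogawski's
«central character of `i_G(χ_ξ)` on `z·1₃`: exponent `2p + 3q + 2t + 1 = a + b + c`» read at the archimedean place of `ι`.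
[cite: Rogawski1990, §12.3 pp. 174, 178] [cite: Arthur2011Draft, d-p.319 (§6.2 Remark 2)] -/
theorem xiCentralCharArchExponent (ι : L →+* ℂ) (ξ : OneDimAutRepH L) (μω : HeckeCharacter L) (hμu : μω.IsUnitary)
    (hμω : ∀ x : Literature.NumberTheory.GaloisRepresentations.ideleGroup ↥(maximalRealSubfield L),
        μω (AdeleRing.ideleBaseChange (↥(maximalRealSubfield L)) L x) = quadraticHeckeCharCM L x)
    (h : ∀ y : ↥(relNormOneInfUnits (↥(maximalRealSubfield L)) L),
        ξ.η (adelicOneEquivTorus (↥(maximalRealSubfield L)) L (IsCMField.complexConj L)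
            ((cmAdelicOneEquivRelNormOne L).symm (relNormOneInfToIdeles (↥(maximalRealSubfield L)) L y))) ^ 2 *
          ξ.ψ (adelicOneEquivTorus (↥(maximalRealSubfield L)) L (IsCMField.complexConj L)
            ((cmAdelicOneEquivRelNormOne L).symm (relNormOneInfToIdeles (↥(maximalRealSubfield L)) L y))) ^ 3 *
          μω (((cmAdelicOneEquivRelNormOne L).symm (relNormOneInfToIdeles (↥(maximalRealSubfield L)) L y) :
            ↥(adelicOne (↥(maximalRealSubfield L)) L (IsCMField.complexConj L))) : ideleGroup L) = 1) :
    3 * ξ.qψ ι + 2 * (ξ.pη ι + ArchSignRecipe.tOfArchType (archTypeOfRecord μω) ι) + 1 = 0 := by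
  have hk := hasUnitaryArchType_archTypeOfRecord μω hμu hμω
  have hrel := archType_eq_of_trivial ξ hk h (InfinitePlace.mk ι)
  obtain ⟨j, hj⟩ := odd_archTypeOfRecord μω hμu hμω (InfinitePlace.mk ι)
  unfold ArchSignRecipe.tOfArchType OneDimAutRepH.qψ OneDimAutRepH.pη OneDimAutRepH.expAt
  split_ifs with hι <;> omega

/-- The same, as the universally quantified sentence — the body of the letter `XiCentralCharArchExponentLetter` of the «ZENTRUM» sub-leaf
(LH1-plan (g4) sketch v4) TOKEN FOR TOKEN, so the letter closes by this name. [cite: Rogawski1990, §12.3 pp. 174, 178] -/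
theorem xiCentralCharArchExponent_forall :
    ∀ (L : Type) [Field L] [NumberField L] [IsCMField L] (ι : L →+* ℂ) (ξ : OneDimAutRepH L)
      (μω : HeckeCharacter L), μω.IsUnitary →
      (∀ x : Literature.NumberTheory.GaloisRepresentations.ideleGroup ↥(maximalRealSubfield L),
          μω (AdeleRing.ideleBaseChange (↥(maximalRealSubfield L)) L x) = quadraticHeckeCharCM L x) →
      (∀ y : ↥(relNormOneInfUnits (↥(maximalRealSubfield L)) L),
          ξ.η (adelicOneEquivTorus (↥(maximalRealSubfield L)) L (IsCMField.complexConj L) ((cmAdelicOneEquivRelNormOne L).symm (relNormOneInfToIdeles (↥(maximalRealSubfield L)) L y))) ^ 2 *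
            ξ.ψ (adelicOneEquivTorus (↥(maximalRealSubfield L)) L (IsCMField.complexConj L) ((cmAdelicOneEquivRelNormOne L).symm (relNormOneInfToIdeles (↥(maximalRealSubfield L)) L y))) ^ 3 *
            μω (((cmAdelicOneEquivRelNormOne L).symm (relNormOneInfToIdeles (↥(maximalRealSubfield L)) L y) : ↥(adelicOne (↥(maximalRealSubfield L)) L (IsCMField.complexConj L))) : ideleGroup L) = 1) →
      3 * ξ.qψ ι + 2 * (ξ.pη ι + ArchSignRecipe.tOfArchType (archTypeOfRecord μω) ι) + 1 = 0 :=
  fun _ _ _ _ ι ξ μω hμu hμω h => xiCentralCharArchExponent ι ξ μω hμu hμω h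

end Summit.HodgeConjecture.HodgeConjecture.Cruxes.H413.F0P3cXiCentralCharArchExponent

end
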